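import Literature.MathematicalPhysics.QuantumFieldTheory.Balaban1983to89.B1Ineq233LowerZeroFieldRegion
import Literature.MathematicalPhysics.QuantumFieldTheory.Balaban1983to89.B1Ineq234LevelZero

/-!
# `Balaban1983to89.B1Ineq234ZeroFieldRegion` — T. Bałaban, *(Higgs)₂,₃ quantum fields in a finite volume. I. A lower bound*,
# Commun. Math. Phys. **85** (1982) 603–626 [Balaban1982Higgs1], Proposition 2.3 pp. 611–612: the kernel bounds **(2.34)**
# `|C^{(k)}_Λ(Ω,A;x,x′)| ≦ c₀e^{−δ₀|x−x′|}`, **(2.36)** `|δC^{(k)}_Λ(Ω,A;x,x′)| ≦ c₀e^{−δ₀(|x−x′|+dist(x,Λᶜ)+dist(x′,Λᶜ))}` and the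
# shape of **(2.38)**, FOR THE PRINTED REGIONS `Ω = B^k(Ω^{(k)})` AND CONDITIONING SETS `Λ ⊂ Ω^{(k)}`, in the printed reading
# *"For an operator A defined on configurations φ : Ω^{(k)} → R^N"* (p. 611), for the CONCRETE conditional covariances
# `HiggsCondCov232.condCov232` of the (Higgs)₂,₃ model: §1–§2 the route of [Balaban1983RegularityDecay] Sect. 5 run on the
# `Ω^{(k)}`-configurations (coercivity needed ONLY on the fields supported in `Ω^{(k)}`); §3 AT ZERO FIELD — `1 ≤ k < K` given
# only the [B4] Corollary-2.3 pairing decay of `G^ε_k(Ω,0)`, and `k = 0` UNCONDITIONALLY (every union of blocks `Ω ⊂ T_ε`)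

statement-level skeleton of published theorems with citation tags; proofs where landed; nothing here is a claim about the Yang–Mills mass gap

PDFs held: `paper:balaban1982-cmp85-higgs23-i` (journal page = PDF page + 602), pp. 610–612 [PDF 8–10] READ AS IMAGES on the ×2
renders `run/shared/lean/pub/pub-balaban/b2b-balaban-ref1/pages/1982-cmp85-higgs23-I/1982-cmp85-higgs23-I-p009-x2.png`, `-p010-x2.png`;
`paper:balaban1983-cmp89-regularity-decay` pp. 593–594 [PDF 23–24] (Sect. 5: (5.1)–(5.10)).

CITATION HEADER (lean-in-tree rule).  Cell `lit-balaban` (HOME `run/shared/lean/pub/lit-balaban/`), seat **r14** gen 9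
(reader/typer of B1/B2, fold owner of SKELETON row **B1.Prop2.3**; unit `lit-balaban-r14-g9`).  WHAT IS REPRODUCED: row
B1.Prop2.3, members (2.34)/(2.36)/(2.38), kind «by-reference derivation for the concrete carrier, printed regions» (§1–§2) and
«model instance at zero field» (§3): the decls of record `B1.Prop23Literal` / `B1.Prop23Intended` (pv07) are UNTOUCHED; this
file only COMPOSES, by name, the kernel-proved engine `B4Sect5Torus.sect5_uniform` (pv23/pv09, the §5 Theorem of [13] over an
arbitrary index set), r14 g7's `B1Ineq234Concrete` (carrier dictionary `rho`/`profile`/`distC`, `blkIn_mat_inv_eq`,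
`hker_precOpA_succ_of_sep`, `mat_precOpA_sub`), the typer's `HiggsCondCov232` (`condCov232`, `restrictInv`, `isUnit_padOp_precOpA`)
and `HiggsCondGauss228` (`inSet`, `blkIn`), own r14 g8 `B1Ineq233LowerZeroFieldRegion` ((2.33)ₗ at zero field for the
`Ω^{(k)}`-supported fields) and r14 g7 `B1Ineq234LevelZero` ((5.4) at level `0`).  Nothing is redefined; no definition in this file.

WHAT IS PRINTED.  B1 p. 611 [PDF 9]: *"Beside the covariances (2.31), we will need the covariances which are obtained by
conditioning with respect to some set Λ ⊂ Ω^{(k)}. For an operator A defined on configurations φ : Ω^{(k)} → R^N we define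
A↾_Λ as an operator on configurations φ : Λ → R^N by the formula A↾_Λφ = ΛAΛφ. We will use the following covariances also
C^{(k)}_Λ(Ω, A) = ((aL^{−2}P(A) + Δ^{(k)}(Ω, A))↾_Λ)^{−1}. (2.32) Here we will assume that the set Λ is a union of big blocks of
T₁^{(k)}. Proposition 2.3. If a configuration A is regular on Ω in the sense defined in Proposition 2.1, then there exist positive
constants δ₀, c₀, γ₀, γ₁, dependent on d and a, and independent of A, k, Ω and Λ, such that γ₀I ≦ aL^{−2}P(A) + Δ^{(k)}(Ω, A) ≦ γ₁I,
(2.33) |C^{(k)}_Λ(Ω, A; x, x′)| ≦ c₀ exp(−δ₀|x − x′|), x, x′ ∈ Λ. (2.34) In particular the above inequality holds for C^{(k)}(Ω, A).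
Putting δC^{(k)}_Λ(Ω, A) = C^{(k)}_Λ(Ω, A) − C^{(k)}(Ω, A), (2.35)"*; p. 612 [PDF 10]: *"we have |δC^{(k)}_Λ(Ω, A; x, x′)| ≦
c₀ exp(−δ₀(|x − x′| + dist(x, Λᶜ) + dist(x′, Λᶜ))), x, x′ ∈ Λ. (2.36) Finally, for Ω ⊂ Ω₀ and δC^{(k)}_Λ(Ω, Ω₀, A) = C^{(k)}_Λ(Ω, A)
− C^{(k)}_Λ(Ω₀, A), (2.37) we have similarly |δC^{(k)}_Λ(Ω, Ω₀, A; x, x′)| ≦ c₀ exp(−δ₀(|x − x′| + dist(x, Ω^{(k)c}) + dist(x′,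
Ω^{(k)c}))), x, x′ ∈ Λ. (2.38)"*; p. 610 [PDF 8]: *"Let a set Ω satisfies Ω = B^k(Ω^{(k)}) and let Ω^{(k)} ⊂ T₁^{(k)} be a sum of big
blocks"*, *"In this paper we will use the case Ω = T_ε only, but in the second part the necessity of the considerations of more
general Ω will arise."*  [13] p. 594 [PDF 24]: *"From these properties it follows that Proposition I.2.3 is a consequence of the
following Theorem. Let A be a symmetric operator defined on L²(Ω) and such that A ≧ γ₀I, |A(x,x′)| ≦ c₀e^{−δ₀|x−x′|}, x, x′ ∈ Ω.
(5.6) Then for arbitrary Λ ⊂ Ω the operator A_Λ = ΛAΛ (on L²(Λ)) is invertible and its inverse C_Λ = A_Λ^{−1} satisfies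
|C_Λ(x,x′)| ≦ c₁e^{−δ₁|x−x′|}, x, x′ ∈ Λ, (5.7) |(C_Λ − C)(x,x′)| ≦ c₁e^{−δ₁(|x−x′| + dist(x,Λᶜ) + dist(x′,Λᶜ))}, x, x′ ∈ Λ, C = A^{−1},
(5.8) … (5.10)"*, and *"Finally Corollary 2.3 implies that the considered operator is short-ranged … (5.4)"*.

DICTIONARY (print ↦ Lean).  `Ω^{(k)}` (resp. [13]'s `L²(Ω)`) ↦ a finite set `S` of sites of `T^{(k)}` and the index subtype
`In (inSet N S)` = `S × {components}` (typer, `HiggsCondGauss228.inSet`); [13]'s `A` on `L²(Ω)` ↦ the compression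
`blkIn (inSet N S) (mat M)` of p35's coordinate matrix of an operator `M` on all fields of `T^{(k)}`; *"A ≧ γ₀I"* on `L²(Ω)` ↦
`γ₀‖f‖² ≤ ⟨f, Mf⟩` FOR THE FIELDS `f` VANISHING OFF `S` (`hlow`); `C_Λ = A_Λ^{−1}` ↦ the `Λ`-block of `mat (restrictInv Λ M)` (typer),
for the model `condCov232 C Ω A m² a k Λ` (2.32); the printed `C^{(k)}(Ω, A)` (inverse on the `Ω^{(k)}`-configurations) ↦
`condCov232 … S` (for `S = T^{(k)}`: `fluctCovA`, `condCov232_univ`), so (2.35) ↦ `condCov232 … Λ − condCov232 … S` (the typer's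
`deltaCov235 = condCov232 … Λ − fluctCovA` is its `Ω = T_ε` member); `|x − x′|` ↦ (1.3) `HiggsLattice.Site.tdist` in lattice units
of `T^{(k)}`; `dist(x, Λᶜ)` ↦ r14 g7's `distC Λ` (complement in `T^{(k)}`; it is `≤` the distance to `S ∖ Λ`, so the weight is the
weaker one and the printed bound is implied); at zero field `Ω = B^k(Λ_k)` ↦ p15's `pieceF R j`, `Ω^{(k)} = Λ_k` ↦ `R.block j`
(`k = j + 1`), and at `k = 0` `Ω^{(0)} = Ω` ↦ a union of blocks `Ω ⊂ T_ε` (`hU`).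

WHAT THIS FILE PROVES (kernel-checked, zero `sorry`, standard axioms; theorems only):
* §1 **the §5 Theorem of [13] on the `Λ′`-configurations of the concrete carrier**, for an ARBITRARY operator `M` on the fields of
  `T^{(k)}` that is symmetric for (1.5), coercive ON THE FIELDS SUPPORTED IN `Λ′` and short-ranged on `Λ′ × Λ′`:
  `hyp56_blkIn_of_supported` ((5.6) for the compression; the form bound is tested on zero extensions,
  `fieldCoord_symm_apply_eq_zero`), **`restrictInv_decay_of_supported`** ((5.7) for `(M↾_Λ)^{−1}`, `Λ ⊂ Λ′`),
  **`restrictInv_sub_restrictInv_decay_of_subset`** ((5.8) with `C = (M↾_{Λ′})^{−1}`), **`restrictInv_sub_restrictInv_decay_of_supported`**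
  ((5.10) for two such operators) — constants `(cSt, dSt)(N·K_d; γ₀, c₀, δ₀)` independent of `Λ`, `Λ′`, `k`, torus; r14 g7's
  `B1Ineq234Concrete.restrictInv_decay`/`restrictInv_sub_inv_decay`/`restrictInv_sub_restrictInv_decay` are the case `Λ′ = T^{(k)}`.
* §2 **`ineq234_region`**, **`ineq236_region`**, **`ineq238_region`**: (2.34), (2.36) (printed reading of (2.35)) and the (2.38) shape
  for the concrete `condCov232 C Ω A m² a k Λ`, `Λ ⊂ S`, every `k ≤ K`, `Ω`, `A`, `ChargeData`, torus, GIVEN (2.33)ₗ on the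
  `S`-supported fields and (5.4) on `S × S` (+ (5.5) on `S × S` for (2.38)); `m² > 0`, `a > 0`, `L > 1` (invertibility (2.32),
  typer's `isUnit_padOp_precOpA`).
* §3 AT ZERO FIELD: `lower_supported_zeroField_region` (own p268021's (2.33)ₗ in the supported form, via `extL_restrict_eq`),
  **`ineq234_zeroField_region_of_ker`** (given (5.4)), **`ineq234_zeroField_region_of_sep`** / **`ineq236_zeroField_region_of_sep`**
  (`1 ≤ k = j+1 < K`, `Λ_k = R.block j` a union of blocks, `Ω = B^k(Λ_k)`, every `Λ ⊂ Λ_k`, `L^kε ≤ 1`; GIVEN ONLY the Cor.-2.3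
  pairing bound `|⟨g, G^ε_k(Ω,0)g′⟩| ≤ c₀e^{−δ₀R/L^k}‖g‖‖g′‖` for supports `≥ R` apart — explicit `(c₁, δ₁)` through `cSt`/`dSt`
  at `γ = min{a, 8γ₀}/L²`, `γ₀` = p15's `gamma0`), and at level `0` **`ineq234_zeroField_region_levelZero`** /
  **`ineq236_zeroField_region_levelZero`**: for EVERY union of blocks `Ω ⊂ T_ε`, every `Λ ⊂ Ω`, every `ε`, NO displayed input left
  ((5.4) at level `0` = r14 g7's `hker_precOpA_levelZero`; coercivity `min{a,8}/L²·ε^{−2}` = r14 g8's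
  `ineq233_lower_zeroField_region_levelZero`).
HONEST SCOPE.  (i) §1–§2 are by-reference derivations: the inputs (2.33)ₗ (on the supported fields) and (5.4)/(5.5) are
hypotheses there, exactly as in [13] p. 594; for general regular `A ≠ 0` they are [B4] Prop. II.3.1′ / Cor. 2.3 (statement only
on this carrier; p17's `B4Prop23RegularFamily` proves the model instance on the b04 carrier).  (ii) §3 `k ≥ 1`: the Cor.-2.3
pairing decay of `G^ε_k(Ω, 0)` for a REGION `Ω ≠ T_ε` is NOT in the tree (p14's `B1Cor23ZeroFieldTorus.propagatorK_pairing_bound`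
is `Ω = T_ε`), so `_of_sep` stays conditional on exactly that printed input; `k = 0` is unconditional.  (iii) Constants: `(cSt, dSt)`
depend on `(d, N, a, L, m²)` and, on the `L^kε`-lattice, on the scale through `(L^kε)^{−2}` in `c₀` (the print states the bounds on the
unit lattice, where this factor is `1`; cf. `B1Ineq233LowerZeroFieldTorus.ineq233_lower_zeroField_unitAt`); at `k = 0` they carry
`ε^{−2}` and `m²` explicitly — no uniformity in `ε` is claimed at level `0` beyond what the formulas show.  (iv) `Λ` is an ARBITRARY
subset of `S` (the print: unions of big blocks — weaker hypothesis, printed case covered); "a sum of big blocks" for `Ω^{(k)}` enters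
only as "a sum of blocks" (`hU`).  (v) `dist(x, Λᶜ)` is taken in `T^{(k)}` (see DICTIONARY).  (vi) Value = kernel certificate that the
printed (2.34)/(2.36)/(2.38) follow, for the printed class of regions and conditioning sets, from the printed inputs on the concrete
carrier, and hold outright at zero field at level `0`; NOT summit progress.  Unit `lit-balaban-r14-g9`
(literature-prover-lit-balaban-r14-g9-0); HOME/FILED.md records the proposal.
-/

open scoped BigOperators InnerProductSpace Matrix

namespace Literature.MathematicalPhysics.QuantumFieldTheory.Balaban1983to89.B1Ineq234ZeroFieldRegion

open HiggsLattice HiggsCovariance B1Eq221Coordinates B1Eq230FluctCov B1Eq230FluctCovPos HiggsCondCov232 HiggsCondGauss228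
open HiggsFluctMeasurePos (siteInner_self_pos siteInner_comm)
open B2Eq228Conditioning (In blkIn)
open B4Sect5Torus (IsPseudoDist SumBound Hyp56 Hyp59 cSt dSt sect5_uniform)
open HiggsFluctMeasure (coeff221)
open B2Eq337ScalarIntegration (Regions V)
open B2Eq328ConcretePieces (LSite pieceF)
open B2Eq328DeltaK (extL)
open B2Prop31ZeroFieldConcrete (gamma0 gamma0_pos extL_apply_of extL_apply_of_not)
open B1Ineq233LowerZeroFieldTorus (lowConst_pos)
open B1Ineq233LowerZeroFieldRegion (ineq233_lower_zeroField_region_uniform ineq233_lower_zeroField_region_levelZero)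
open B1Ineq234Concrete (rho rho_eq_tdist rho_isPseudoDist rho_sumBound profile profile_nonneg' distC distC_le
  distC_nonneg mat_isSymm dotProduct_mat_mulVec dotProduct_self_eq_siteInner blkIn_mat_inv_eq)
open Matrix

variable {P : HiggsLattice.Params} {N : ℕ} {k : ℕ}

/-! ## §1 The §5 Theorem of [13] on the configurations SUPPORTED IN `Λ′ ⊂ T^{(k)}` -/

section Supported

variable {M : Module.End ℝ (ScalarField P k N)}

/-- A coordinate vector vanishing off `Λ′ × {components}` is the coordinate vector of a field vanishing off `Λ′`.
[cite: Balaban1982Higgs1, (2.32) p.611] -/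
theorem fieldCoord_symm_apply_eq_zero (Λ' : Finset (HiggsLattice.Site P k)) {w : HiggsLattice.Site P k × Ix N → ℝ}
    (hw : ∀ p : HiggsLattice.Site P k × Ix N, p.1 ∉ Λ' → w p = 0) {x : HiggsLattice.Site P k} (hx : x ∉ Λ') :
    (fieldCoord (E N) (HiggsLattice.Site P k)).symm w x = 0 := by
  set φ := (fieldCoord (E N) (HiggsLattice.Site P k)).symm w with hφ
  have h1 : siteCoord (E N) (φ x) = 0 := by
    funext i
    change fieldCoord (E N) (HiggsLattice.Site P k) φ (x, i) = 0
    rw [hφ, LinearEquiv.apply_symm_apply]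
    exact hw (x, i) hx
  exact (siteCoord (E N)).map_eq_zero_iff.mp h1

/-- **(5.6) for the compression to the `Λ′`-configurations, from coercivity on the `Λ′`-SUPPORTED fields only** — the
printed setting of [13] Sect. 5 (*"A be a symmetric operator defined on L²(Ω)"*, here `Ω = Λ′ × {components}`) and of
I p. 611 (*"For an operator A defined on configurations φ : Ω^{(k)} → R^N"*): symmetry for (1.5), the form lower bound
`γ₀‖f‖² ≤ ⟨f, Mf⟩` for the fields `f` vanishing off `Λ′`, and the kernel bound on `Λ′ × Λ′` give the engine's `Hyp56` for
the `Λ′`-block of the coordinate matrix, with the torus distance (1.3). [cite: Balaban1983RegularityDecay, (5.6) p.594] -/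
theorem hyp56_blkIn_of_supported {γ₀ c₀ δ₀ : ℝ} (Λ' : Finset (HiggsLattice.Site P k))
    (hsymm : ∀ f g : ScalarField P k N, siteInner f (M g) = siteInner g (M f))
    (hlow : ∀ f : ScalarField P k N, (∀ x, x ∉ Λ' → f x = 0) → γ₀ * siteInner f f ≤ siteInner f (M f))
    (hker : ∀ p q : HiggsLattice.Site P k × Ix N, p.1 ∈ Λ' → q.1 ∈ Λ' →
      |mat M p q| ≤ c₀ * Real.exp (-(δ₀ * (HiggsLattice.Site.tdist p.1 q.1 : ℝ)))) :
    Hyp56 (fun i j : In (inSet (P := P) N Λ') => rho i.val j.val) (blkIn (inSet N Λ') (mat M)) γ₀ c₀ δ₀ := by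
  refine ⟨(mat_isSymm hsymm).submatrix _, fun v => ?_, fun i j => ?_⟩
  swap
  · change |mat M i.val j.val| ≤ c₀ * Real.exp (-(δ₀ * rho i.val j.val))
    rw [rho_eq_tdist]; exact hker _ _ i.2 j.2
  have he : Function.Injective (Subtype.val : In (inSet (P := P) N Λ') → HiggsLattice.Site P k × Ix N) :=
    Subtype.val_injective
  set w : HiggsLattice.Site P k × Ix N → ℝ := Function.extend (Subtype.val : In (inSet (P := P) N Λ') → _) v 0 with hw
  have hwe : ∀ i : In (inSet (P := P) N Λ'), w i.val = v i := fun i => he.extend_apply _ _ _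
  have hw0 : ∀ p, (¬ ∃ i : In (inSet (P := P) N Λ'), i.val = p) → w p = 0 := fun p hp => by
    rw [hw, Function.extend_apply' _ _ _ hp, Pi.zero_apply]
  have hw0' : ∀ p : HiggsLattice.Site P k × Ix N, p.1 ∉ Λ' → w p = 0 := fun p hp =>
    hw0 p (by rintro ⟨i, rfl⟩; exact hp i.2)
  -- the form bound for `w`, from `hlow` on the field with coordinates `w` (it vanishes off `Λ′`)
  have hf0 : ∀ x, x ∉ Λ' → (fieldCoord (E N) (HiggsLattice.Site P k)).symm w x = 0 := fun x hx =>
    fieldCoord_symm_apply_eq_zero Λ' hw0' hx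
  have h : γ₀ * ∑ p, w p ^ 2 ≤ ∑ p, w p * (mat M).mulVec w p := by
    have h1 : ∑ p, w p ^ 2 = w ⬝ᵥ w := by simp [dotProduct, sq]
    have h2 : ∑ p, w p * (mat M *ᵥ w) p = w ⬝ᵥ (mat M *ᵥ w) := rfl
    rw [h1, h2, dotProduct_mat_mulVec, dotProduct_self_eq_siteInner, mul_left_comm]
    exact mul_le_mul_of_nonneg_left (hlow _ hf0) (inv_nonneg.mpr (pow_pos (P.mesh_pos k) _).le)
  have e1 : ∑ p, w p ^ 2 = ∑ i : In (inSet (P := P) N Λ'), v i ^ 2 := by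
    rw [B4Sect5Torus.sum_eq_sum_range he (fun p => w p ^ 2) (fun p hp => by rw [hw0 p hp]; ring)]
    simp only [hwe]
  have e2 : ∀ p, (mat M).mulVec w p = ∑ j : In (inSet (P := P) N Λ'), mat M p j.val * v j := by
    intro p
    simp only [Matrix.mulVec, dotProduct]
    rw [B4Sect5Torus.sum_eq_sum_range he (fun q => mat M p q * w q) (fun q hq => by rw [hw0 q hq, mul_zero])]
    simp only [hwe]
  have e3 : ∑ p, w p * (mat M).mulVec w p =
      ∑ i : In (inSet (P := P) N Λ'), v i * (blkIn (inSet N Λ') (mat M)).mulVec v i := by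
    rw [B4Sect5Torus.sum_eq_sum_range he (fun p => w p * (mat M).mulVec w p)
      (fun p hp => by rw [hw0 p hp, zero_mul])]
    apply Finset.sum_congr rfl
    intro i _
    rw [hwe, e2]
    simp [Matrix.mulVec, dotProduct, blkIn, Matrix.submatrix_apply]
  rw [← e1, ← e3]
  exact h

/-- **(5.7) for `(M↾_Λ)^{−1}`, `Λ ⊂ Λ′`, from coercivity of `M` on the `Λ′`-SUPPORTED fields** (and symmetry, and the kernel
bound on `Λ′ × Λ′`): `|(M↾_Λ)^{−1}(p, q)| ≤ c₁e^{−δ₁|x_p − x_q|}`, `p, q ∈ Λ × {components}`, `(c₁, δ₁) = (cSt, dSt)(N·K_d;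
γ₀, c₀, δ₀)` independent of `Λ`, `Λ′`, `k` and the torus — the §5 Theorem of [13] applied, as printed, to the operator ON THE
`Λ′`-CONFIGURATIONS (engine `B4Sect5Torus.sect5_uniform` on the index set `Λ′ × {components}`; r14 g7's
`B1Ineq234Concrete.restrictInv_decay` is the case `Λ′ = T^{(k)}`).  `hU`: invertibility of `M↾_Λ` (for the model:
`HiggsCondCov232.isUnit_padOp_precOpA`). [cite: Balaban1983RegularityDecay, (5.7) p.594] -/
theorem restrictInv_decay_of_supported {γ₀ c₀ δ₀ : ℝ} (hγ : 0 < γ₀) (hc : 0 < c₀) (hδ : 0 < δ₀)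
    {Λ Λ' : Finset (HiggsLattice.Site P k)} (hΛ : Λ ⊆ Λ')
    (hsymm : ∀ f g : ScalarField P k N, siteInner f (M g) = siteInner g (M f))
    (hU : IsUnit (padOp Λ M))
    (hlow : ∀ f : ScalarField P k N, (∀ x, x ∉ Λ' → f x = 0) → γ₀ * siteInner f f ≤ siteInner f (M f))
    (hker : ∀ p q : HiggsLattice.Site P k × Ix N, p.1 ∈ Λ' → q.1 ∈ Λ' →
      |mat M p q| ≤ c₀ * Real.exp (-(δ₀ * (HiggsLattice.Site.tdist p.1 q.1 : ℝ))))
    {p q : HiggsLattice.Site P k × Ix N} (hp : p.1 ∈ Λ) (hq : q.1 ∈ Λ) :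
    |mat (restrictInv Λ M) p q| ≤
      cSt (profile P N) γ₀ c₀ δ₀ *
        Real.exp (-(dSt (profile P N) γ₀ c₀ δ₀ * (HiggsLattice.Site.tdist p.1 q.1 : ℝ))) := by
  have he : Function.Injective
      (fun i : In (inSet (P := P) N Λ) => (⟨i.val, hΛ i.property⟩ : In (inSet (P := P) N Λ'))) :=
    fun i j h => Subtype.ext (by simpa using congrArg Subtype.val h)
  have main := (sect5_uniform (profile_nonneg' (P := P) (N := N)) hγ hc hδ
    (rho_isPseudoDist.comp Subtype.val) (rho_sumBound.comp Subtype.val_injective)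
    (hyp56_blkIn_of_supported Λ' hsymm hlow hker) he).1 ⟨p, hp⟩ ⟨q, hq⟩
  have main2 : |(blkIn (inSet N Λ) (mat M))⁻¹ ⟨p, hp⟩ ⟨q, hq⟩| ≤
      cSt (profile P N) γ₀ c₀ δ₀ * Real.exp (-(dSt (profile P N) γ₀ c₀ δ₀ * rho p q)) := main
  rw [blkIn_mat_inv_eq Λ hU] at main2
  rw [← rho_eq_tdist]
  exact main2

/-- **(5.8) in the printed reading for regions** — `|((M↾_Λ)^{−1} − (M↾_{Λ′})^{−1})(p, q)| ≤
c₁e^{−δ₁(|x_p − x_q| + dist(x_p, Λᶜ) + dist(x_q, Λᶜ))}`, `p, q ∈ Λ × {components}`, `Λ ⊂ Λ′`: the inverse "on the whole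
space" of [13] (5.8) is the inverse ON THE `Λ′`-CONFIGURATIONS (I p. 611: `C^{(k)}(Ω, A)` acts on the configurations
`φ : Ω^{(k)} → R^N`), under the hypotheses of `restrictInv_decay_of_supported`; `dist(x, Λᶜ)` = `distC Λ` (complement in
`T^{(k)}`, which is `≤` the distance to `Λ′ ∖ Λ`, so the printed weight is covered). [cite: Balaban1983RegularityDecay, (5.8) p.594] -/
theorem restrictInv_sub_restrictInv_decay_of_subset {γ₀ c₀ δ₀ : ℝ} (hγ : 0 < γ₀) (hc : 0 < c₀) (hδ : 0 < δ₀)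
    {Λ Λ' : Finset (HiggsLattice.Site P k)} (hΛ : Λ ⊆ Λ')
    (hsymm : ∀ f g : ScalarField P k N, siteInner f (M g) = siteInner g (M f))
    (hU : IsUnit (padOp Λ M)) (hU' : IsUnit (padOp Λ' M))
    (hlow : ∀ f : ScalarField P k N, (∀ x, x ∉ Λ' → f x = 0) → γ₀ * siteInner f f ≤ siteInner f (M f))
    (hker : ∀ p q : HiggsLattice.Site P k × Ix N, p.1 ∈ Λ' → q.1 ∈ Λ' →
      |mat M p q| ≤ c₀ * Real.exp (-(δ₀ * (HiggsLattice.Site.tdist p.1 q.1 : ℝ))))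
    {p q : HiggsLattice.Site P k × Ix N} (hp : p.1 ∈ Λ) (hq : q.1 ∈ Λ) :
    |mat (restrictInv Λ M) p q - mat (restrictInv Λ' M) p q| ≤
      cSt (profile P N) γ₀ c₀ δ₀ *
        Real.exp (-(dSt (profile P N) γ₀ c₀ δ₀ *
          ((HiggsLattice.Site.tdist p.1 q.1 : ℝ) + distC Λ p.1 + distC Λ q.1))) := by
  have he : Function.Injective
      (fun i : In (inSet (P := P) N Λ) => (⟨i.val, hΛ i.property⟩ : In (inSet (P := P) N Λ'))) :=
    fun i j h => Subtype.ext (by simpa using congrArg Subtype.val h)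
  have main := (sect5_uniform (profile_nonneg' (P := P) (N := N)) hγ hc hδ
    (rho_isPseudoDist.comp Subtype.val) (rho_sumBound.comp Subtype.val_injective)
    (hyp56_blkIn_of_supported Λ' hsymm hlow hker) he).2.1
    (fun i => distC Λ i.val.1) (fun i => distC_nonneg Λ _) ?_ ⟨p, hp⟩ ⟨q, hq⟩
  · have main2 : |(blkIn (inSet N Λ) (mat M))⁻¹ ⟨p, hp⟩ ⟨q, hq⟩
          - (blkIn (inSet N Λ') (mat M))⁻¹ ⟨p, hΛ hp⟩ ⟨q, hΛ hq⟩| ≤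
        cSt (profile P N) γ₀ c₀ δ₀ *
          Real.exp (-(dSt (profile P N) γ₀ c₀ δ₀ * (rho p q + distC Λ p.1 + distC Λ q.1))) := main
    rw [blkIn_mat_inv_eq Λ hU, blkIn_mat_inv_eq Λ' hU'] at main2
    rw [← rho_eq_tdist]
    exact main2
  · intro i z hz
    have hz' : z.val.1 ∉ Λ := fun hzΛ => hz ⟨⟨z.val, hzΛ⟩, Subtype.ext rfl⟩
    change distC Λ i.val.1 ≤ rho i.val z.val
    rw [rho_eq_tdist]
    exact distC_le Λ _ hz'

/-- **(5.10) in the printed reading for regions** — two operators `M` (for `Ω`) and `M₀` (for `Ω₀`), both symmetric,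
both coercive on the `Λ′`-SUPPORTED fields, both with the kernel bound on `Λ′ × Λ′`, whose difference obeys (5.9) on
`Λ′ × Λ′` for a nonnegative boundary weight `w` with `w(x) ≤ |x − y| + w(y)` (the print's `dist(x, Ω^{(k)c})`): for
`Λ ⊂ Λ′`, `|((M↾_Λ)^{−1} − (M₀↾_Λ)^{−1})(p, q)| ≤ c₁e^{−δ₁(|x_p − x_q| + w(x_p) + w(x_q))}`, `p, q ∈ Λ × {components}`.
[cite: Balaban1983RegularityDecay, (5.10) p.594] -/
theorem restrictInv_sub_restrictInv_decay_of_supported {M₀ : Module.End ℝ (ScalarField P k N)} {γ₀ c₀ δ₀ : ℝ}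
    (hγ : 0 < γ₀) (hc : 0 < c₀) (hδ : 0 < δ₀)
    {Λ Λ' : Finset (HiggsLattice.Site P k)} (hΛ : Λ ⊆ Λ')
    (hsymm : ∀ f g : ScalarField P k N, siteInner f (M g) = siteInner g (M f))
    (hU : IsUnit (padOp Λ M))
    (hlow : ∀ f : ScalarField P k N, (∀ x, x ∉ Λ' → f x = 0) → γ₀ * siteInner f f ≤ siteInner f (M f))
    (hker : ∀ p q : HiggsLattice.Site P k × Ix N, p.1 ∈ Λ' → q.1 ∈ Λ' →
      |mat M p q| ≤ c₀ * Real.exp (-(δ₀ * (HiggsLattice.Site.tdist p.1 q.1 : ℝ))))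
    (hsymm₀ : ∀ f g : ScalarField P k N, siteInner f (M₀ g) = siteInner g (M₀ f))
    (hU₀ : IsUnit (padOp Λ M₀))
    (hlow₀ : ∀ f : ScalarField P k N, (∀ x, x ∉ Λ' → f x = 0) → γ₀ * siteInner f f ≤ siteInner f (M₀ f))
    (hker₀ : ∀ p q : HiggsLattice.Site P k × Ix N, p.1 ∈ Λ' → q.1 ∈ Λ' →
      |mat M₀ p q| ≤ c₀ * Real.exp (-(δ₀ * (HiggsLattice.Site.tdist p.1 q.1 : ℝ))))
    {w : HiggsLattice.Site P k → ℝ} (hw0 : ∀ x, 0 ≤ w x)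
    (hwLip : ∀ x y, w x ≤ (HiggsLattice.Site.tdist x y : ℝ) + w y)
    (hdiff : ∀ p q : HiggsLattice.Site P k × Ix N, p.1 ∈ Λ' → q.1 ∈ Λ' →
      |mat M₀ p q - mat M p q| ≤
        c₀ * Real.exp (-(δ₀ * ((HiggsLattice.Site.tdist p.1 q.1 : ℝ) + w p.1 + w q.1))))
    {p q : HiggsLattice.Site P k × Ix N} (hp : p.1 ∈ Λ) (hq : q.1 ∈ Λ) :
    |mat (restrictInv Λ M) p q - mat (restrictInv Λ M₀) p q| ≤
      cSt (profile P N) γ₀ c₀ δ₀ *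
        Real.exp (-(dSt (profile P N) γ₀ c₀ δ₀ *
          ((HiggsLattice.Site.tdist p.1 q.1 : ℝ) + w p.1 + w q.1))) := by
  have he : Function.Injective
      (fun i : In (inSet (P := P) N Λ) => (⟨i.val, hΛ i.property⟩ : In (inSet (P := P) N Λ'))) :=
    fun i j h => Subtype.ext (by simpa using congrArg Subtype.val h)
  have hAB : blkIn (inSet N Λ') (mat M) + (blkIn (inSet N Λ') (mat M₀) - blkIn (inSet N Λ') (mat M))
      = blkIn (inSet N Λ') (mat M₀) := add_sub_cancel _ _
  have h56 : Hyp56 (fun i j : In (inSet (P := P) N Λ') => rho i.val j.val)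
      (blkIn (inSet N Λ') (mat M) + (blkIn (inSet N Λ') (mat M₀) - blkIn (inSet N Λ') (mat M))) γ₀ c₀ δ₀ := by
    rw [hAB]; exact hyp56_blkIn_of_supported Λ' hsymm₀ hlow₀ hker₀
  have h59 : Hyp59 (fun i j : In (inSet (P := P) N Λ') => rho i.val j.val) (fun s => w s.val.1)
      (blkIn (inSet N Λ') (mat M₀) - blkIn (inSet N Λ') (mat M)) c₀ δ₀ := by
    intro s t
    change |mat M₀ s.val t.val - mat M s.val t.val| ≤ c₀ * Real.exp (-(δ₀ * (rho s.val t.val + w s.val.1 + w t.val.1)))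
    rw [rho_eq_tdist]
    exact hdiff s.val t.val s.2 t.2
  have main := (sect5_uniform (profile_nonneg' (P := P) (N := N)) hγ hc hδ
    (rho_isPseudoDist.comp Subtype.val) (rho_sumBound.comp Subtype.val_injective)
    (hyp56_blkIn_of_supported Λ' hsymm hlow hker) he).2.2
    (blkIn (inSet N Λ') (mat M₀) - blkIn (inSet N Λ') (mat M)) (fun s => w s.val.1) h56 (fun s => hw0 s.val.1)
    (fun s t => by rw [rho_eq_tdist]; exact hwLip s.val.1 t.val.1)
    h59 ⟨p, hp⟩ ⟨q, hq⟩
  rw [hAB] at main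
  have main2 : |(blkIn (inSet N Λ) (mat M))⁻¹ ⟨p, hp⟩ ⟨q, hq⟩ - (blkIn (inSet N Λ) (mat M₀))⁻¹ ⟨p, hp⟩ ⟨q, hq⟩| ≤
      cSt (profile P N) γ₀ c₀ δ₀ *
        Real.exp (-(dSt (profile P N) γ₀ c₀ δ₀ * (rho p q + w p.1 + w q.1))) := main
  rw [blkIn_mat_inv_eq Λ hU, blkIn_mat_inv_eq Λ hU₀] at main2
  rw [← rho_eq_tdist]
  exact main2

end Supported

/-! ## §2 Proposition 2.3 (2.34), (2.36), (2.38) for the CONCRETE `C^{(k)}_Λ(Ω,A)` in the printed reading, `Λ ⊂ Ω^{(k)}` -/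

section Concrete

variable (C : ChargeData N) (Ω : Finset (HiggsLattice.Site P 0)) (A : HiggsLattice.VecField P 0) (msq a : ℝ)

/-- **(2.34) FOR THE CONCRETE MODEL AND THE PRINTED REGIONS** — *"|C^{(k)}_Λ(Ω, A; x, x′)| ≦ c₀ exp(−δ₀|x − x′|), x, x′ ∈ Λ.
(2.34)"* with `Λ ⊂ Ω^{(k)}` (p. 611: *"conditioning with respect to some set Λ ⊂ Ω^{(k)}"*): for every level `k ≤ K`, every
`Ω`, `A`, `ChargeData`, torus, every finite `S ⊂ T^{(k)}` (the print's `Ω^{(k)}`) and `Λ ⊂ S`, IF the precision operator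
`a(L^{k+1}ε)^{−2}P(A) + Δ^{(k)}(Ω,A)` (`B1Eq230FluctCov.precOpA`) obeys the lower half (2.33)ₗ ON THE FIELDS SUPPORTED IN `S`
(the printed reading *"on configurations φ : Ω^{(k)} → R^N"*) and the short-range bound (5.4) on `S × S`, THEN the coordinate
kernel of `C^{(k)}_Λ(Ω,A) = HiggsCondCov232.condCov232 C Ω A m² a k Λ` obeys (2.34) with `(c₁, δ₁) = (cSt, dSt)(N·K_d; γ₀, c₀, δ₀)`
— *"independent of A, k, Ω and Λ"* (and of `S` and the torus); `m² > 0`, `a > 0`, `L > 1` give the invertibility (2.32)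
(`isUnit_padOp_precOpA`). [cite: Balaban1982Higgs1, Prop. 2.3 (2.34) p.611] -/
theorem ineq234_region {γ₀ c₀ δ₀ : ℝ} (hγ : 0 < γ₀) (hc : 0 < c₀) (hδ : 0 < δ₀)
    (hmsq : 0 < msq) (ha : 0 < a) (hL : 1 < P.L) (hk : k ≤ P.K) (S : Finset (HiggsLattice.Site P k))
    (hlow : ∀ f : ScalarField P k N, (∀ x, x ∉ S → f x = 0) →
      γ₀ * siteInner f f ≤ siteInner f (precOpA C Ω A msq a k f))
    (hker : ∀ p q : HiggsLattice.Site P k × Ix N, p.1 ∈ S → q.1 ∈ S →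
      |mat (precOpA C Ω A msq a k) p q| ≤ c₀ * Real.exp (-(δ₀ * (HiggsLattice.Site.tdist p.1 q.1 : ℝ))))
    {Λ : Finset (HiggsLattice.Site P k)} (hΛ : Λ ⊆ S) {p q : HiggsLattice.Site P k × Ix N} (hp : p.1 ∈ Λ)
    (hq : q.1 ∈ Λ) :
    |mat (condCov232 C Ω A msq a k Λ) p q| ≤
      cSt (profile P N) γ₀ c₀ δ₀ *
        Real.exp (-(dSt (profile P N) γ₀ c₀ δ₀ * (HiggsLattice.Site.tdist p.1 q.1 : ℝ))) := by
  have hLr : (1 : ℝ) < P.L := by exact_mod_cast hL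
  exact restrictInv_decay_of_supported hγ hc hδ hΛ (siteInner_precOpA_comm C Ω A msq a k)
    (isUnit_padOp_precOpA C Ω A hmsq ha hLr hk Λ) hlow hker hp hq

/-- **(2.36) FOR THE CONCRETE MODEL AND THE PRINTED REGIONS** — *"|δC^{(k)}_Λ(Ω, A; x, x′)| ≦ c₀ exp(−δ₀(|x − x′| + dist(x, Λᶜ)
+ dist(x′, Λᶜ))), x, x′ ∈ Λ. (2.36)"* with (2.35) `δC^{(k)}_Λ(Ω, A) = C^{(k)}_Λ(Ω, A) − C^{(k)}(Ω, A)` READ AS PRINTED for a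
region `Ω ≠ T_ε`: `C^{(k)}(Ω, A)` is the inverse on the configurations `φ : Ω^{(k)} → R^N` (p. 611), i.e. the member `Λ = S`
of the typer's family, `condCov232 … S` (for `S = T^{(k)}` it is `fluctCovA`, `HiggsCondCov232.condCov232_univ`, and the
difference below is the typer's `deltaCov235`).  Same hypotheses and constants as `ineq234_region`; `dist(x, Λᶜ)` = `distC Λ`.
[cite: Balaban1982Higgs1, Prop. 2.3 (2.35)–(2.36) pp.611–612] -/
theorem ineq236_region {γ₀ c₀ δ₀ : ℝ} (hγ : 0 < γ₀) (hc : 0 < c₀) (hδ : 0 < δ₀)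
    (hmsq : 0 < msq) (ha : 0 < a) (hL : 1 < P.L) (hk : k ≤ P.K) (S : Finset (HiggsLattice.Site P k))
    (hlow : ∀ f : ScalarField P k N, (∀ x, x ∉ S → f x = 0) →
      γ₀ * siteInner f f ≤ siteInner f (precOpA C Ω A msq a k f))
    (hker : ∀ p q : HiggsLattice.Site P k × Ix N, p.1 ∈ S → q.1 ∈ S →
      |mat (precOpA C Ω A msq a k) p q| ≤ c₀ * Real.exp (-(δ₀ * (HiggsLattice.Site.tdist p.1 q.1 : ℝ))))
    {Λ : Finset (HiggsLattice.Site P k)} (hΛ : Λ ⊆ S) {p q : HiggsLattice.Site P k × Ix N} (hp : p.1 ∈ Λ)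
    (hq : q.1 ∈ Λ) :
    |mat (condCov232 C Ω A msq a k Λ) p q - mat (condCov232 C Ω A msq a k S) p q| ≤
      cSt (profile P N) γ₀ c₀ δ₀ *
        Real.exp (-(dSt (profile P N) γ₀ c₀ δ₀ *
          ((HiggsLattice.Site.tdist p.1 q.1 : ℝ) + distC Λ p.1 + distC Λ q.1))) := by
  have hLr : (1 : ℝ) < P.L := by exact_mod_cast hL
  exact restrictInv_sub_restrictInv_decay_of_subset hγ hc hδ hΛ (siteInner_precOpA_comm C Ω A msq a k)
    (isUnit_padOp_precOpA C Ω A hmsq ha hLr hk Λ) (isUnit_padOp_precOpA C Ω A hmsq ha hLr hk S) hlow hker hp hq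

/-- **(2.38)-SHAPE FOR THE CONCRETE MODEL AND THE PRINTED REGIONS** — *"for Ω ⊂ Ω₀ and δC^{(k)}_Λ(Ω, Ω₀, A) = C^{(k)}_Λ(Ω, A) −
C^{(k)}_Λ(Ω₀, A), (2.37) we have similarly |δC^{(k)}_Λ(Ω, Ω₀, A; x, x′)| ≦ c₀ exp(−δ₀(|x − x′| + dist(x, Ω^{(k)c}) +
dist(x′, Ω^{(k)c}))), x, x′ ∈ Λ. (2.38)"*: for two regions `Ω, Ω₀` (any), `S ⊂ T^{(k)}` (the print's `Ω^{(k)}`) and `Λ ⊂ S`,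
GIVEN (2.33)ₗ for both precision operators on the `S`-supported fields, (5.4) for both on `S × S` and the localisation input
(5.5) `|(Δ^{(k)}(Ω₀,A) − Δ^{(k)}(Ω,A))(p,q)| ≤ c₀e^{−δ₀(|x_p−x_q| + w(x_p) + w(x_q))}` on `S × S` for a nonnegative Lipschitz boundary
weight `w` (the print's `w = dist(·, Ω^{(k)c})`), the coordinate kernel of (2.37) obeys (2.38) with that weight and the same
`(c₁, δ₁)`. [cite: Balaban1982Higgs1, Prop. 2.3 (2.37)–(2.38) p.612] -/
theorem ineq238_region (Ω₀ : Finset (HiggsLattice.Site P 0)) {γ₀ c₀ δ₀ : ℝ} (hγ : 0 < γ₀) (hc : 0 < c₀) (hδ : 0 < δ₀)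
    (hmsq : 0 < msq) (ha : 0 < a) (hL : 1 < P.L) (hk : k ≤ P.K) (S : Finset (HiggsLattice.Site P k))
    (hlow : ∀ f : ScalarField P k N, (∀ x, x ∉ S → f x = 0) →
      γ₀ * siteInner f f ≤ siteInner f (precOpA C Ω A msq a k f))
    (hker : ∀ p q : HiggsLattice.Site P k × Ix N, p.1 ∈ S → q.1 ∈ S →
      |mat (precOpA C Ω A msq a k) p q| ≤ c₀ * Real.exp (-(δ₀ * (HiggsLattice.Site.tdist p.1 q.1 : ℝ))))
    (hlow₀ : ∀ f : ScalarField P k N, (∀ x, x ∉ S → f x = 0) →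
      γ₀ * siteInner f f ≤ siteInner f (precOpA C Ω₀ A msq a k f))
    (hker₀ : ∀ p q : HiggsLattice.Site P k × Ix N, p.1 ∈ S → q.1 ∈ S →
      |mat (precOpA C Ω₀ A msq a k) p q| ≤ c₀ * Real.exp (-(δ₀ * (HiggsLattice.Site.tdist p.1 q.1 : ℝ))))
    {w : HiggsLattice.Site P k → ℝ} (hw0 : ∀ x, 0 ≤ w x)
    (hwLip : ∀ x y, w x ≤ (HiggsLattice.Site.tdist x y : ℝ) + w y)
    (hloc : ∀ p q : HiggsLattice.Site P k × Ix N, p.1 ∈ S → q.1 ∈ S →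
      |mat (deltaKA C Ω₀ A msq a k) p q - mat (deltaKA C Ω A msq a k) p q| ≤
        c₀ * Real.exp (-(δ₀ * ((HiggsLattice.Site.tdist p.1 q.1 : ℝ) + w p.1 + w q.1))))
    {Λ : Finset (HiggsLattice.Site P k)} (hΛ : Λ ⊆ S) {p q : HiggsLattice.Site P k × Ix N} (hp : p.1 ∈ Λ)
    (hq : q.1 ∈ Λ) :
    |mat (condCov232 C Ω A msq a k Λ) p q - mat (condCov232 C Ω₀ A msq a k Λ) p q| ≤
      cSt (profile P N) γ₀ c₀ δ₀ *
        Real.exp (-(dSt (profile P N) γ₀ c₀ δ₀ *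
          ((HiggsLattice.Site.tdist p.1 q.1 : ℝ) + w p.1 + w q.1))) := by
  have hLr : (1 : ℝ) < P.L := by exact_mod_cast hL
  have hdiff : ∀ p q : HiggsLattice.Site P k × Ix N, p.1 ∈ S → q.1 ∈ S →
      |mat (precOpA C Ω₀ A msq a k : Module.End ℝ (ScalarField P k N)) p q
          - mat (precOpA C Ω A msq a k : Module.End ℝ (ScalarField P k N)) p q| ≤
        c₀ * Real.exp (-(δ₀ * ((HiggsLattice.Site.tdist p.1 q.1 : ℝ) + w p.1 + w q.1))) := by
    intro s t hs ht
    have h := congrFun (congrFun (B1Ineq234Concrete.mat_precOpA_sub C Ω A msq a Ω₀ k) s) t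
    simp only [Matrix.sub_apply] at h
    rw [h]
    exact hloc s t hs ht
  exact restrictInv_sub_restrictInv_decay_of_supported hγ hc hδ hΛ (siteInner_precOpA_comm C Ω A msq a k)
    (isUnit_padOp_precOpA C Ω A hmsq ha hLr hk Λ) hlow hker (siteInner_precOpA_comm C Ω₀ A msq a k)
    (isUnit_padOp_precOpA C Ω₀ A hmsq ha hLr hk Λ) hlow₀ hker₀ hw0 hwLip hdiff hp hq

end Concrete

/-! ## §3 At zero field: (2.34)/(2.36) for the printed regions, `k ≥ 1` given the Cor. 2.3 pairing, `k = 0` unconditionally -/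

section ZeroField

variable {K : ℕ} (R : Regions P K) (C : ChargeData N) {a msq : ℝ}

/-- A field on `T^{(k)}` vanishing off `Λ_k` IS the zero extension `ψ̃` of its restriction `ψ = f↾_{Λ_k}` (p15's `extL`).
[cite: Balaban1982Higgs2, (3.24) p.588] -/
theorem extL_restrict_eq (j : Fin K) {f : ScalarField P (j.val + 1) N} (hf : ∀ y, y ∉ R.block j → f y = 0) :
    extL R j (fun y : LSite R j => f y.val) = f := by
  funext y
  by_cases h : y ∈ R.block j
  · exact extL_apply_of R j _ h
  · rw [extL_apply_of_not R j _ h, hf y h]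

/-- **(2.33)ₗ at zero field in the supported form the §5 route consumes** (own `B1Ineq233LowerZeroFieldRegion`, r14 g8):
for `Λ_k = R.block j` a union of blocks, `Ω = B^k(Λ_k)` (p15's `pieceF R j`), `1 ≤ k = j + 1 < K`, `L^kε ≤ 1`, and EVERY field
`f` on `T^{(k)}` vanishing off `Λ_k`: `(min{a, 8γ₀}/L²)‖f‖² ≤ ⟨f, (a(L^{k+1}ε)^{−2}P(0) + Δ^{(k),L^kε}(Ω, 0))f⟩`, `γ₀ = p15's gamma0`.
[cite: Balaban1982Higgs1, Prop. 2.3 (2.33) p.611] -/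
theorem lower_supported_zeroField_region (ha : 0 < a) (hL : 1 < P.L) (hmsq : 0 < msq) (hK : K ≤ P.K) (j : Fin K)
    (hjK : j.val + 1 < P.K) (hs : P.mesh (j.val + 1) ≤ 1)
    (hU : ∀ y y' : HiggsLattice.Site P (j.val + 1),
      HiggsLattice.blockOf y = HiggsLattice.blockOf y' → (y ∈ R.block j ↔ y' ∈ R.block j))
    (f : ScalarField P (j.val + 1) N) (hf : ∀ y, y ∉ R.block j → f y = 0) :
    min a (8 * gamma0 P a msq) / (P.L : ℝ) ^ 2 * siteInner f f
      ≤ siteInner f (precOpA C (pieceF R j) (0 : HiggsLattice.VecField P 0) msq a (j.val + 1) f) := by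
  have h := ineq233_lower_zeroField_region_uniform R C ha hL hmsq hK j hjK hs hU (fun y : LSite R j => f y.val)
  rwa [extL_restrict_eq R j hf] at h

/-- The short-range constant of r14 g7's `hker_precOpA_succ_of_sep` is positive (`a > 0`, `c₀ ≥ 0`).
[cite: Balaban1983RegularityDecay, (5.4) p.594] -/
theorem kerConst_succ_pos (ha : 0 < a) (j : ℕ) {c₀ : ℝ} (hc : 0 ≤ c₀) (δ₀ : ℝ) :
    0 < a * ((P.mesh (j + 1 + 1))⁻¹ ^ 2) * Real.exp (δ₀ * ((P.L : ℝ) - 1)) +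
      (|coeff221 P a (j + 1)| + coeff221 P a (j + 1) ^ 2 * (c₀ * Real.exp δ₀)) :=
  add_pos_of_pos_of_nonneg (mul_pos (mul_pos ha (pow_pos (inv_pos.mpr (P.mesh_pos _)) 2)) (Real.exp_pos _))
    (add_nonneg (abs_nonneg _) (mul_nonneg (sq_nonneg _) (mul_nonneg hc (Real.exp_pos _).le)))

/-- **(2.34) AT ZERO FIELD FOR THE PRINTED REGIONS, `1 ≤ k < K`, GIVEN (5.4)**: for `Λ_k = R.block j` a union of blocks,
`Ω = B^k(Λ_k)`, `Λ ⊂ Λ_k`, `L^kε ≤ 1`, `m² > 0`, `a > 0`, `L > 1`, and the short-range bound (5.4) for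
`a(L^{k+1}ε)^{−2}P(0) + Δ^{(k)}(Ω, 0)` on `Λ_k × Λ_k` (constants `c₀ > 0`, `δ₀ > 0`): `|C^{(k)}_Λ(Ω, 0; p, q)| ≤ c₁e^{−δ₁|x_p − x_q|}`
on `Λ`, `(c₁, δ₁) = (cSt, dSt)(N·K_d; min{a, 8γ₀}/L², c₀, δ₀)` — the lower half (2.33)ₗ being DISCHARGED by
`lower_supported_zeroField_region`. [cite: Balaban1982Higgs1, Prop. 2.3 (2.34) p.611] -/
theorem ineq234_zeroField_region_of_ker (ha : 0 < a) (hL : 1 < P.L) (hmsq : 0 < msq) (hK : K ≤ P.K) (j : Fin K)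
    (hjK : j.val + 1 < P.K) (hs : P.mesh (j.val + 1) ≤ 1)
    (hU : ∀ y y' : HiggsLattice.Site P (j.val + 1),
      HiggsLattice.blockOf y = HiggsLattice.blockOf y' → (y ∈ R.block j ↔ y' ∈ R.block j))
    {c₀ δ₀ : ℝ} (hc : 0 < c₀) (hδ : 0 < δ₀)
    (hker : ∀ p q : HiggsLattice.Site P (j.val + 1) × Ix N, p.1 ∈ R.block j → q.1 ∈ R.block j →
      |mat (precOpA C (pieceF R j) (0 : HiggsLattice.VecField P 0) msq a (j.val + 1)) p q| ≤
        c₀ * Real.exp (-(δ₀ * (HiggsLattice.Site.tdist p.1 q.1 : ℝ))))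
    {Λ : Finset (HiggsLattice.Site P (j.val + 1))} (hΛ : Λ ⊆ R.block j)
    {p q : HiggsLattice.Site P (j.val + 1) × Ix N} (hp : p.1 ∈ Λ) (hq : q.1 ∈ Λ) :
    |mat (condCov232 C (pieceF R j) (0 : HiggsLattice.VecField P 0) msq a (j.val + 1) Λ) p q| ≤
      cSt (profile P N) (min a (8 * gamma0 P a msq) / (P.L : ℝ) ^ 2) c₀ δ₀ *
        Real.exp (-(dSt (profile P N) (min a (8 * gamma0 P a msq) / (P.L : ℝ) ^ 2) c₀ δ₀ *
          (HiggsLattice.Site.tdist p.1 q.1 : ℝ))) :=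
  ineq234_region C (pieceF R j) 0 msq a (lowConst_pos ha hL hmsq.le) hc hδ hmsq ha hL hjK.le (R.block j)
    (fun f hf => lower_supported_zeroField_region R C ha hL hmsq hK j hjK hs hU f hf) hker hΛ hp hq

/-- **(2.34) AT ZERO FIELD FOR THE PRINTED REGIONS, `1 ≤ k < K`, GIVEN ONLY THE [B4] COROLLARY-2.3 PAIRING DECAY OF
`G^ε_k(Ω, 0)`** — [13] p. 594 *"Finally Corollary 2.3 implies that the considered operator is short-ranged … (5.4)"*: the
`P(0)`/`Q_k` bookkeeping of r14 g7's `B1Ineq234Concrete.hker_precOpA_succ_of_sep` turns the pairing bound `|⟨g, G^ε_k(Ω,0)g′⟩|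
≤ c₀e^{−δ₀R/L^k}‖g‖‖g′‖` (supports `≥ R` apart in (1.3)) into (5.4), and `lower_supported_zeroField_region` supplies (2.33)ₗ; so
for `Λ_k = R.block j` a union of blocks, `Ω = B^k(Λ_k)`, every `Λ ⊂ Λ_k`: `|C^{(k)}_Λ(Ω, 0; p, q)| ≤ c₁e^{−δ₁|x_p − x_q|}` on `Λ` with
the explicit `(c₁, δ₁)` below (`c₀ ≥ 0`, `δ₀ > 0`; `L^kε ≤ 1`, `m² > 0`, `a > 0`, `L > 1`).  The pairing decay itself (= [B4]
Cor. 2.3 for the region `Ω` at `A = 0`) is NOT proved here. [cite: Balaban1982Higgs1, Prop. 2.3 (2.34) p.611] -/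
theorem ineq234_zeroField_region_of_sep (ha : 0 < a) (hL : 1 < P.L) (hmsq : 0 < msq) (hK : K ≤ P.K) (j : Fin K)
    (hjK : j.val + 1 < P.K) (hs : P.mesh (j.val + 1) ≤ 1)
    (hU : ∀ y y' : HiggsLattice.Site P (j.val + 1),
      HiggsLattice.blockOf y = HiggsLattice.blockOf y' → (y ∈ R.block j ↔ y' ∈ R.block j))
    {c₀ δ₀ : ℝ} (hc : 0 ≤ c₀) (hδ : 0 < δ₀)
    (hSep : ∀ (ρ : ℝ) (g g' : ScalarField P 0 N),
      (∀ x x', g x ≠ 0 → g' x' ≠ 0 → ρ ≤ (HiggsLattice.Site.tdist x x' : ℝ)) →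
        |siteInner g (propagatorK C (pieceF R j) (0 : HiggsLattice.VecField P 0) msq a (j.val + 1) g')| ≤
          c₀ * Real.exp (-(δ₀ * (ρ / (P.L : ℝ) ^ (j.val + 1)))) *
            Real.sqrt (siteInner g g) * Real.sqrt (siteInner g' g'))
    {Λ : Finset (HiggsLattice.Site P (j.val + 1))} (hΛ : Λ ⊆ R.block j)
    {p q : HiggsLattice.Site P (j.val + 1) × Ix N} (hp : p.1 ∈ Λ) (hq : q.1 ∈ Λ) :
    |mat (condCov232 C (pieceF R j) (0 : HiggsLattice.VecField P 0) msq a (j.val + 1) Λ) p q| ≤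
      cSt (profile P N) (min a (8 * gamma0 P a msq) / (P.L : ℝ) ^ 2)
          (a * ((P.mesh (j.val + 1 + 1))⁻¹ ^ 2) * Real.exp (δ₀ * ((P.L : ℝ) - 1)) +
            (|coeff221 P a (j.val + 1)| + coeff221 P a (j.val + 1) ^ 2 * (c₀ * Real.exp δ₀))) δ₀ *
        Real.exp (-(dSt (profile P N) (min a (8 * gamma0 P a msq) / (P.L : ℝ) ^ 2)
          (a * ((P.mesh (j.val + 1 + 1))⁻¹ ^ 2) * Real.exp (δ₀ * ((P.L : ℝ) - 1)) +
            (|coeff221 P a (j.val + 1)| + coeff221 P a (j.val + 1) ^ 2 * (c₀ * Real.exp δ₀))) δ₀ *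
          (HiggsLattice.Site.tdist p.1 q.1 : ℝ))) :=
  ineq234_zeroField_region_of_ker R C ha hL hmsq hK j hjK hs hU (kerConst_succ_pos ha j.val hc δ₀) hδ
    (fun p q _ _ => B1Ineq234Concrete.hker_precOpA_succ_of_sep C (pieceF R j) 0 msq a hjK ha.le hc hδ.le hSep p q)
    hΛ hp hq

/-- **(2.36) AT ZERO FIELD FOR THE PRINTED REGIONS, `1 ≤ k < K`, GIVEN ONLY THE COROLLARY-2.3 PAIRING DECAY OF `G^ε_k(Ω, 0)`**,
in the printed reading of (2.35) (`C^{(k)}(Ω, 0)` = the inverse on the `Ω^{(k)}`-configurations, `condCov232 … (R.block j)`):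
`|(C^{(k)}_Λ(Ω, 0) − C^{(k)}(Ω, 0))(p, q)| ≤ c₁e^{−δ₁(|x_p − x_q| + dist(x_p, Λᶜ) + dist(x_q, Λᶜ))}` on `Λ ⊂ Λ_k`, same constants as
`ineq234_zeroField_region_of_sep`. [cite: Balaban1982Higgs1, Prop. 2.3 (2.36) p.612] -/
theorem ineq236_zeroField_region_of_sep (ha : 0 < a) (hL : 1 < P.L) (hmsq : 0 < msq) (hK : K ≤ P.K) (j : Fin K)
    (hjK : j.val + 1 < P.K) (hs : P.mesh (j.val + 1) ≤ 1)
    (hU : ∀ y y' : HiggsLattice.Site P (j.val + 1),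
      HiggsLattice.blockOf y = HiggsLattice.blockOf y' → (y ∈ R.block j ↔ y' ∈ R.block j))
    {c₀ δ₀ : ℝ} (hc : 0 ≤ c₀) (hδ : 0 < δ₀)
    (hSep : ∀ (ρ : ℝ) (g g' : ScalarField P 0 N),
      (∀ x x', g x ≠ 0 → g' x' ≠ 0 → ρ ≤ (HiggsLattice.Site.tdist x x' : ℝ)) →
        |siteInner g (propagatorK C (pieceF R j) (0 : HiggsLattice.VecField P 0) msq a (j.val + 1) g')| ≤
          c₀ * Real.exp (-(δ₀ * (ρ / (P.L : ℝ) ^ (j.val + 1)))) *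
            Real.sqrt (siteInner g g) * Real.sqrt (siteInner g' g'))
    {Λ : Finset (HiggsLattice.Site P (j.val + 1))} (hΛ : Λ ⊆ R.block j)
    {p q : HiggsLattice.Site P (j.val + 1) × Ix N} (hp : p.1 ∈ Λ) (hq : q.1 ∈ Λ) :
    |mat (condCov232 C (pieceF R j) (0 : HiggsLattice.VecField P 0) msq a (j.val + 1) Λ) p q
        - mat (condCov232 C (pieceF R j) (0 : HiggsLattice.VecField P 0) msq a (j.val + 1) (R.block j)) p q| ≤
      cSt (profile P N) (min a (8 * gamma0 P a msq) / (P.L : ℝ) ^ 2)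
          (a * ((P.mesh (j.val + 1 + 1))⁻¹ ^ 2) * Real.exp (δ₀ * ((P.L : ℝ) - 1)) +
            (|coeff221 P a (j.val + 1)| + coeff221 P a (j.val + 1) ^ 2 * (c₀ * Real.exp δ₀))) δ₀ *
        Real.exp (-(dSt (profile P N) (min a (8 * gamma0 P a msq) / (P.L : ℝ) ^ 2)
          (a * ((P.mesh (j.val + 1 + 1))⁻¹ ^ 2) * Real.exp (δ₀ * ((P.L : ℝ) - 1)) +
            (|coeff221 P a (j.val + 1)| + coeff221 P a (j.val + 1) ^ 2 * (c₀ * Real.exp δ₀))) δ₀ *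
          ((HiggsLattice.Site.tdist p.1 q.1 : ℝ) + distC Λ p.1 + distC Λ q.1))) :=
  ineq236_region C (pieceF R j) 0 msq a (lowConst_pos ha hL hmsq.le) (kerConst_succ_pos ha j.val hc δ₀) hδ hmsq ha hL
    hjK.le (R.block j) (fun f hf => lower_supported_zeroField_region R C ha hL hmsq hK j hjK hs hU f hf)
    (fun p q _ _ => B1Ineq234Concrete.hker_precOpA_succ_of_sep C (pieceF R j) 0 msq a hjK ha.le hc hδ.le hSep p q)
    hΛ hp hq

end ZeroField

section LevelZero

variable (C : ChargeData N) (Ω : Finset (HiggsLattice.Site P 0)) {a msq : ℝ}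

/-- The coercivity constant of (2.33)ₗ at level `0` for regions, `min{a, 8}/L² · ε^{−2}`, is positive (`a > 0`, `L ≥ 1`).
[cite: Balaban1982Higgs1, Prop. 2.3 (2.33) p.611] -/
theorem lowConst_levelZero_pos (ha : 0 < a) (hL : 1 < P.L) :
    0 < min a 8 / (P.L : ℝ) ^ 2 * ((P.mesh 0)⁻¹ ^ 2) := by
  have hL0 : (0 : ℝ) < (P.L : ℝ) := by exact_mod_cast (lt_trans Nat.zero_lt_one hL)
  exact mul_pos (div_pos (lt_min ha (by norm_num)) (pow_pos hL0 2)) (pow_pos (inv_pos.mpr (P.mesh_pos 0)) 2)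

/-- **(2.34) AT LEVEL `k = 0` AND ZERO FIELD FOR THE PRINTED REGIONS, UNCONDITIONAL**: for every `Ω ⊂ T_ε` that is a union of
blocks, every `Λ ⊂ Ω`, `m² > 0`, `a > 0`, `L > 1`, `0 < K`, every `ε` and every rate parameter `δ > 0`:
`|C^{(0),ε}_Λ(Ω, 0; p, q)| ≤ c₁e^{−δ₁|x_p − x_q|}` on `Λ`, `(c₁, δ₁) = (cSt, dSt)(N·K_d; min{a,8}/L²·ε^{−2}, c₀(δ), δ)` with r14 g7's
`c₀(δ) = a(Lε)^{−2}e^{δ(L−1)} + (4dε^{−2} + m²)e^{δ}` (`B1Ineq234LevelZero.hker_precOpA_levelZero`, every `A`, `Ω`) and the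
coercivity `min{a,8}/L²·ε^{−2}` on the `Ω`-supported fields of own `ineq233_lower_zeroField_region_levelZero` (r14 g8) — no
displayed input left. [cite: Balaban1982Higgs1, Prop. 2.3 (2.34) p.611] -/
theorem ineq234_zeroField_region_levelZero (ha : 0 < a) (hL : 1 < P.L) (hmsq : 0 < msq) (hK : 0 < P.K) {δ : ℝ}
    (hδ : 0 < δ)
    (hU : ∀ x x' : HiggsLattice.Site P 0, HiggsLattice.blockOf x = HiggsLattice.blockOf x' → (x ∈ Ω ↔ x' ∈ Ω))
    {Λ : Finset (HiggsLattice.Site P 0)} (hΛ : Λ ⊆ Ω) {p q : HiggsLattice.Site P 0 × Ix N} (hp : p.1 ∈ Λ)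
    (hq : q.1 ∈ Λ) :
    |mat (condCov232 C Ω (0 : HiggsLattice.VecField P 0) msq a 0 Λ) p q| ≤
      cSt (profile P N) (min a 8 / (P.L : ℝ) ^ 2 * ((P.mesh 0)⁻¹ ^ 2))
          (a * ((P.mesh (0 + 1))⁻¹ ^ 2) * Real.exp (δ * ((P.L : ℝ) - 1)) +
            (4 * P.d * (P.mesh 0)⁻¹ ^ 2 + msq) * Real.exp δ) δ *
        Real.exp (-(dSt (profile P N) (min a 8 / (P.L : ℝ) ^ 2 * ((P.mesh 0)⁻¹ ^ 2))
          (a * ((P.mesh (0 + 1))⁻¹ ^ 2) * Real.exp (δ * ((P.L : ℝ) - 1)) +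
            (4 * P.d * (P.mesh 0)⁻¹ ^ 2 + msq) * Real.exp δ) δ *
          (HiggsLattice.Site.tdist p.1 q.1 : ℝ))) :=
  ineq234_region C Ω 0 msq a (lowConst_levelZero_pos ha hL) (B1Ineq234LevelZero.kerConst_levelZero_pos msq a ha.le hmsq δ)
    hδ hmsq ha hL (Nat.zero_le _) Ω
    (fun f hf => ineq233_lower_zeroField_region_levelZero C Ω ha.le hmsq.le hK hU f hf)
    (fun p q _ _ => B1Ineq234LevelZero.hker_precOpA_levelZero C Ω 0 msq a hK ha.le hmsq.le hδ.le p q) hΛ hp hq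

/-- **(2.36) AT LEVEL `k = 0` AND ZERO FIELD FOR THE PRINTED REGIONS, UNCONDITIONAL**, in the printed reading of (2.35)
(`C^{(0)}(Ω, 0)` = the inverse on the `Ω`-configurations, `condCov232 … Ω`): with the data of
`ineq234_zeroField_region_levelZero`, `|(C^{(0),ε}_Λ(Ω, 0) − C^{(0),ε}(Ω, 0))(p, q)| ≤ c₁e^{−δ₁(|x_p − x_q| + dist(x_p, Λᶜ) +
dist(x_q, Λᶜ))}` on `Λ ⊂ Ω`. [cite: Balaban1982Higgs1, Prop. 2.3 (2.36) p.612] -/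
theorem ineq236_zeroField_region_levelZero (ha : 0 < a) (hL : 1 < P.L) (hmsq : 0 < msq) (hK : 0 < P.K) {δ : ℝ}
    (hδ : 0 < δ)
    (hU : ∀ x x' : HiggsLattice.Site P 0, HiggsLattice.blockOf x = HiggsLattice.blockOf x' → (x ∈ Ω ↔ x' ∈ Ω))
    {Λ : Finset (HiggsLattice.Site P 0)} (hΛ : Λ ⊆ Ω) {p q : HiggsLattice.Site P 0 × Ix N} (hp : p.1 ∈ Λ)
    (hq : q.1 ∈ Λ) :
    |mat (condCov232 C Ω (0 : HiggsLattice.VecField P 0) msq a 0 Λ) p q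
        - mat (condCov232 C Ω (0 : HiggsLattice.VecField P 0) msq a 0 Ω) p q| ≤
      cSt (profile P N) (min a 8 / (P.L : ℝ) ^ 2 * ((P.mesh 0)⁻¹ ^ 2))
          (a * ((P.mesh (0 + 1))⁻¹ ^ 2) * Real.exp (δ * ((P.L : ℝ) - 1)) +
            (4 * P.d * (P.mesh 0)⁻¹ ^ 2 + msq) * Real.exp δ) δ *
        Real.exp (-(dSt (profile P N) (min a 8 / (P.L : ℝ) ^ 2 * ((P.mesh 0)⁻¹ ^ 2))
          (a * ((P.mesh (0 + 1))⁻¹ ^ 2) * Real.exp (δ * ((P.L : ℝ) - 1)) +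
            (4 * P.d * (P.mesh 0)⁻¹ ^ 2 + msq) * Real.exp δ) δ *
          ((HiggsLattice.Site.tdist p.1 q.1 : ℝ) + distC Λ p.1 + distC Λ q.1))) :=
  ineq236_region C Ω 0 msq a (lowConst_levelZero_pos ha hL) (B1Ineq234LevelZero.kerConst_levelZero_pos msq a ha.le hmsq δ)
    hδ hmsq ha hL (Nat.zero_le _) Ω
    (fun f hf => ineq233_lower_zeroField_region_levelZero C Ω ha.le hmsq.le hK hU f hf)
    (fun p q _ _ => B1Ineq234LevelZero.hker_precOpA_levelZero C Ω 0 msq a hK ha.le hmsq.le hδ.le p q) hΛ hp hq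

end LevelZero

end Literature.MathematicalPhysics.QuantumFieldTheory.Balaban1983to89.B1Ineq234ZeroFieldRegion
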